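import Mathlib
import Literature.Geometry.Lorentzian.KerrConvergence
import Literature.Geometry.Lorentzian.TameChartCompactness
import Literature.Geometry.Lorentzian.CurvatureNaturality
import Literature.Geometry.Lorentzian.ImmersionChartMetric
import Literature.Geometry.Lorentzian.ChartConnection
import Literature.Geometry.Lorentzian.OpensChartGeodesicODE
import Literature.Geometry.Lorentzian.LeviCivitaProofs
import Summits.FinalStateConjecture.FinalStateConjecture.Theorems.PhotonSphereChannelsTameCensorshipChristoffelBound
import Summits.FinalStateConjecture.FinalStateConjecture.Theorems.PhotonSphereChannelsTameCensorshipChartRiemannBound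
import Summits.FinalStateConjecture.FinalStateConjecture.Theorems.PhotonSphereChannelsTameCensorshipChartGeodesic
import Summits.FinalStateConjecture.FinalStateConjecture.Theorems.PhotonSphereChannelsTameCensorshipPancakeGlue

/-!
# Route PhotonSphereChannels · crux `TameCensorship` (stmt-FinalStateConjecture-17431) · line `Sketch`, wave 4 ·
# stub `stub_localFrameBound`: a local frame bound along a null geodesic through a pinned chart

Helper file (`--supports stmt-FinalStateConjecture-17431`) of line `Sketch` (lead c2, 2026-08-17), brick S21 of the
PANCAKE LAW on the compact INITIAL segment of a visible incomplete null geodesic (the initial-segment twin of the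
per-point step of the landed tail form `stub_pancakeLawTail`, without the forced boost).

Setting: a smooth injective open immersion `Ψ : O → 𝓢` of an open `O ∋ 0` of `E4` whose transported metric
`Ψ^* g` (`ImmersionChart.metric`, components `G = ImmersionChart.repr`) is PINNED on a ball `B(0, ρ) ⊆ O`:
`‖G z − η‖ ≤ ½`, `‖DG(z) v‖ ≤ L ‖v‖`, `‖D²G(z)(v, w)‖ ≤ L ‖v‖ ‖w‖` (hypotheses, produced by the neighbouring stubs);
a geodesic `γ` of `𝓢` on an open `dom ∋ s` with null velocity and `Ψ 0 = γ s`. Claim: for `t ∈ dom` near `s` there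
are adapted null frames `f` at `γ t` (`f 0 = γ' t`, `g(f₀,f₁) = −1`, orthonormal screen) whose curvature components
`|g(R(f_a, f_b) f_c, f_d)|` are bounded by ONE constant `B`.

Proof: the chart curve `x = Ψ⁻¹ ∘ γ` on the open `O' = dom ∩ γ⁻¹(range Ψ) ∋ s` is a geodesic of `Ψ^* g` with
`dΨ x' = γ'` (`stub_chartGeodesic_of_injective`), so `x` and `x'` are continuous at `s`
(`OpensChart.hasDerivAt_of_isGeodesicOn`), `x s = 0`, `x' s ≠ 0` (null velocity is non-zero): for `|t − s| < ε`,
`x t ∈ B(0, ρ)` and `m ≤ ‖x' t‖ ≤ M` (`m = ‖x' s‖/2`, `M = 2‖x' s‖`). At such `t` the Christoffel and curvature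
bounds of the pinned chart hold (`stub_christoffelBound`, `stub_chartRiemannBound`: `|R| ≤ (3L + 27L²) ∏‖·‖`), the
adapted frame under the pin (`adaptedNullFrame_of_pin`, `ℓ = x' t`: `‖n‖ ≤ 24/m`, `‖e_A‖ ≤ 74`) pushed forward by
`dΨ` is adapted to `γ' t` (`ImmersionChart.metric_val`, transport along `Ψ (x t) = γ t`), and by naturality of the
Riemann tensor (`val_riemann_immersionChart`, O'Neill 1983, Ch. 3, Prop. 3.59)
`|R(f…)| ≤ (3L + 27L²) · K₀⁴ =: B` with `K₀ = max (max M (24/m)) 74`.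

References: B. O'Neill, *Semi-Riemannian Geometry* (1983), Ch. 3, Prop. 3.59 (naturality of curvature), Cor. 3.21
(geodesic equations in a chart); Ch. 5, Lemma 26 (null frames).
-/

-- the problem namespace `Summit.FinalStateConjecture.FinalStateConjecture.…` repeats a component by design
set_option linter.dupNamespace false
-- instance search through the nested operator type `E4 →L[ℝ] E4 →L[ℝ] ℝ` of metric components
set_option maxSynthPendingDepth 3

open Literature.Geometry.Lorentzian
open scoped Manifold ContDiff Topology
open Set Filter TopologicalSpace

noncomputable section

namespace Summit.FinalStateConjecture.FinalStateConjecture.Theorems.PhotonSphereChannels.TameCensorshipUnwind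

set_option maxHeartbeats 800000 in
/-- **Stub `stub_localFrameBound` of line `Sketch` (wave 4, S21) for the crux `PhotonSphereChannels.TameCensorship`
(stmt-FinalStateConjecture-17431): a local frame bound along a null geodesic through a pinned chart.** Given a smooth
injective open immersion `Ψ : O → 𝓢` (`O ∋ 0` open in `E4`) whose transported metric components
`G = ImmersionChart.repr …` satisfy on a ball `B(0, ρ) ⊆ O` the pin `‖G z − η‖ ≤ ½` and the derivative bounds
`‖DG(z) v‖ ≤ L ‖v‖`, `‖D²G(z)(v, w)‖ ≤ L ‖v‖ ‖w‖`, and a geodesic `γ` of `𝓢` with null velocity on the open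
`dom ∋ s` with `Ψ 0 = γ s`: there are `ε > 0` and `B` such that at every `t ∈ dom` with `|t − s| < ε` there is an
adapted null frame `f` at `γ t` (`f 0 = γ' t`, `g(f₀, f₀) = g(f₁, f₁) = 0`, `g(f₀, f₁) = −1`, `f₂, f₃` orthonormal and
orthogonal to both legs) with `|g(R(f_a, f_b) f_c, f_d)| ≤ B` for all slots. Proof: chart curve `x = Ψ⁻¹ ∘ γ`
(`stub_chartGeodesic_of_injective`, `OpensChart.hasDerivAt_of_isGeodesicOn`), speed window `m ≤ ‖x' t‖ ≤ M` near
`s` by continuity, adapted chart frame under the pin (`adaptedNullFrame_of_pin`) pushed forward by `dΨ`, chart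
curvature bound (`stub_christoffelBound`, `stub_chartRiemannBound`) and naturality (`val_riemann_immersionChart`);
`B = (3L + 27L²) · (max (max M (24/m)) 74)⁴`. [cite: ONeillSemiRiemannian1983, Ch. 3, Prop. 3.59; Ch. 5, Lemma 26] -/
theorem stub_localFrameBound :
    ∀ (𝓢 : Spacetime.{0} 4) [𝓢.metric.HasLeviCivita] (O : TopologicalSpace.Opens E4) (h0 : (0 : E4) ∈ O)
    (Ψ : O → 𝓢.carrier) (hΨ : ContMDiff 𝓘(ℝ, E4) (𝓡 4) (∞ + 1) Ψ)
    (hΨ' : ∀ u, Function.Injective (mfderiv 𝓘(ℝ, E4) (𝓡 4) Ψ u)) (ρ L : ℝ),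
    Function.Injective Ψ → Topology.IsOpenEmbedding Ψ → 0 < ρ → Metric.ball (0 : E4) ρ ⊆ (O : Set E4) →
    (∀ z ∈ Metric.ball (0 : E4) ρ,
      ‖ImmersionChart.repr 𝓢.metric.toPseudoRiemannianMetric hΨ hΨ' rfl z - Minkowski.bilin‖ ≤ 1 / 2 ∧
      (∀ v : E4, ‖fderiv ℝ (ImmersionChart.repr 𝓢.metric.toPseudoRiemannianMetric hΨ hΨ' rfl) z v‖ ≤ L * ‖v‖) ∧
      (∀ v w : E4, ‖fderiv ℝ (fderiv ℝ (ImmersionChart.repr 𝓢.metric.toPseudoRiemannianMetric hΨ hΨ' rfl)) z v w‖ ≤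
        L * ‖v‖ * ‖w‖)) →
    ∀ (γ : ℝ → 𝓢.carrier) (dom : Set ℝ) (s : ℝ), IsOpen dom → IsGeodesicOn 𝓢.metric.leviCivita γ dom →
    (∀ t ∈ dom, 𝓢.metric.IsNull (velocity (𝓡 4) γ t)) → s ∈ dom → Ψ ⟨0, h0⟩ = γ s →
    ∃ ε : ℝ, 0 < ε ∧ ∃ B : ℝ, ∀ t ∈ dom, |t - s| < ε →
      ∃ f : Fin 4 → TangentSpace (𝓡 4) (γ t),
        (f 0 = velocity (𝓡 4) γ t ∧ 𝓢.metric.val (γ t) (f 0) (f 0) = 0 ∧ 𝓢.metric.val (γ t) (f 1) (f 1) = 0 ∧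
          𝓢.metric.val (γ t) (f 0) (f 1) = -1 ∧
          𝓢.metric.val (γ t) (f 2) (f 2) = 1 ∧ 𝓢.metric.val (γ t) (f 3) (f 3) = 1 ∧
          𝓢.metric.val (γ t) (f 2) (f 3) = 0 ∧
          𝓢.metric.val (γ t) (f 0) (f 2) = 0 ∧ 𝓢.metric.val (γ t) (f 0) (f 3) = 0 ∧
          𝓢.metric.val (γ t) (f 1) (f 2) = 0 ∧ 𝓢.metric.val (γ t) (f 1) (f 3) = 0) ∧
        ∀ a b c d : Fin 4,
          |𝓢.metric.val (γ t) (CovariantDerivative.curvature 𝓢.metric.leviCivita (γ t) (f a) (f b) (f c)) (f d)| ≤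
            B := by
  intro 𝓢 _ O h0 Ψ hΨ hΨ' ρ L hinj hemb hρ _hballO hbounds γ dom s hdom hgeo hnull hs hΨ0
  -- the transported metric `Ψ^* g` on `O` and its components
  set gU := ImmersionChart.metric 𝓢.metric.toPseudoRiemannianMetric hΨ hΨ' rfl with hgU
  haveI : gU.HasLeviCivita := gU.hasLeviCivita
  set G : E4 → E4 →L[ℝ] E4 →L[ℝ] ℝ := ImmersionChart.repr 𝓢.metric.toPseudoRiemannianMetric hΨ hΨ' rfl
    with hGdef
  have hG : ∀ y : O, gU.val y = G y := ImmersionChart.metric_val_eq_repr _ hΨ hΨ' rfl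
  have hGd : ∀ y : O, DifferentiableAt ℝ G y := fun y ↦
    (OpensChart.contDiffAt_repr hG y).differentiableAt (by simp)
  -- the constants `0 ≤ L` and `C_R = 3L + 27L²`
  have hL0 : 0 ≤ L := by
    obtain ⟨-, hD1₀, -⟩ := hbounds 0 (Metric.mem_ball_self hρ)
    obtain ⟨v, hv⟩ := exists_ne (0 : E4)
    have h1 := hD1₀ v
    have h2 : 0 < ‖v‖ := norm_pos_iff.2 hv
    nlinarith [norm_nonneg (fderiv ℝ G 0 v)]
  set CR : ℝ := 3 * L + 3 * (3 * L) ^ 2 with hCR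
  have hCR0 : 0 ≤ CR := by positivity
  -- continuity of the geodesic
  have hcont : ∀ t ∈ dom, ContinuousAt γ t := fun t ht ↦
    (IsGeodesicOn.mdifferentiableAt_holds hgeo ht).continuousAt
  -- the chart curve
  classical
  set x : ℝ → O := fun t ↦ if h : γ t ∈ Set.range Ψ then h.choose else ⟨0, h0⟩ with hxdef
  have hxΨ : ∀ t, γ t ∈ Set.range Ψ → Ψ (x t) = γ t := fun t h ↦ by
    simp only [hxdef, dif_pos h]; exact h.choose_spec
  set O' : Set ℝ := dom ∩ γ ⁻¹' (Set.range Ψ) with hO'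
  have hO'open : IsOpen O' :=
    (continuousOn_of_forall_continuousAt hcont).isOpen_inter_preimage hdom hemb.isOpen_range
  have hsO' : s ∈ O' := ⟨hs, Set.mem_range.2 ⟨⟨0, h0⟩, hΨ0⟩⟩
  obtain ⟨hxgeo, hvel⟩ := stub_chartGeodesic_of_injective 𝓢 O Ψ hΨ hΨ' rfl hinj γ x O' hO'open
    (hgeo.mono inter_subset_left) (fun t ht ↦ hxΨ t ht.2)
  -- the geodesic equation in the chart: `x` and `x'` are differentiable, hence continuous, on `O'`
  have hode := fun t (ht : t ∈ O') ↦ OpensChart.hasDerivAt_of_isGeodesicOn hG hGd hxgeo ht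
  set vel : ℝ → E4 := fun t ↦ (velocity 𝓘(ℝ, E4) x t : E4) with hveldef
  have hxs : x s = ⟨0, h0⟩ := hinj ((hxΨ s hsO'.2).trans hΨ0.symm)
  have hxs0 : ((x s : O) : E4) = 0 := by rw [hxs]
  have hvels : (mfderiv 𝓘(ℝ, E4) (𝓡 4) Ψ (x s) (vel s) : E4) = (velocity (𝓡 4) γ s : E4) := hvel s hsO'
  have hvs0 : vel s ≠ 0 := by
    intro h
    have hz : mfderiv 𝓘(ℝ, E4) (𝓡 4) Ψ (x s) (vel s) = 0 := by
      rw [h]; exact map_zero (mfderiv 𝓘(ℝ, E4) (𝓡 4) Ψ (x s))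
    apply (hnull s hs).2
    have e := hvels
    rw [hz] at e
    exact e.symm
  have hvspos : 0 < ‖vel s‖ := norm_pos_iff.2 hvs0
  -- the speed window and the frame-norm constant (independent of `t`)
  set m : ℝ := ‖vel s‖ / 2 with hm
  set M : ℝ := 2 * ‖vel s‖ with hM
  have hmpos : 0 < m := by positivity
  set K₀ : ℝ := max (max M (24 / m)) 74 with hK₀
  have hMK : M ≤ K₀ := (le_max_left _ _).trans (le_max_left _ _)
  have hmK : 24 / m ≤ K₀ := (le_max_right _ _).trans (le_max_left _ _)
  have h74K : (74 : ℝ) ≤ K₀ := le_max_right _ _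
  have hK₀0 : 0 ≤ K₀ := le_trans (by norm_num) h74K
  -- continuity at `s` of the chart curve and of its velocity
  have hcx : ContinuousAt (fun t ↦ ((x t : O) : E4)) s := (hode s hsO').1.continuousAt
  have hcv : ContinuousAt vel s := (hode s hsO').2.continuousAt
  obtain ⟨ε₁, hε₁, hball₁⟩ := Metric.isOpen_iff.1 hO'open s hsO'
  obtain ⟨ε₂, hε₂, hball₂⟩ := Metric.continuousAt_iff.1 hcx ρ hρ
  obtain ⟨ε₃, hε₃, hball₃⟩ := Metric.continuousAt_iff.1 hcv m hmpos
  refine ⟨min ε₁ (min ε₂ ε₃), lt_min hε₁ (lt_min hε₂ hε₃), CR * K₀ ^ 4, fun t ht hts ↦ ?_⟩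
  have hts₁ : |t - s| < ε₁ := lt_of_lt_of_le hts (min_le_left _ _)
  have hts₂ : |t - s| < ε₂ := lt_of_lt_of_le hts ((min_le_right _ _).trans (min_le_left _ _))
  have hts₃ : |t - s| < ε₃ := lt_of_lt_of_le hts ((min_le_right _ _).trans (min_le_right _ _))
  have htO' : t ∈ O' := hball₁ (by rw [Metric.mem_ball, Real.dist_eq]; exact hts₁)
  have hxt : ‖((x t : O) : E4)‖ < ρ := by
    have h := hball₂ (show dist t s < ε₂ by rw [Real.dist_eq]; exact hts₂)
    rwa [dist_eq_norm, hxs0, sub_zero] at h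
  have hvt : ‖vel t - vel s‖ < m := by
    have h := hball₃ (show dist t s < ε₃ by rw [Real.dist_eq]; exact hts₃)
    rwa [dist_eq_norm] at h
  -- the pin and the derivative bounds at `x t`, the Christoffel and curvature bounds there
  have hzt : ((x t : O) : E4) ∈ Metric.ball (0 : E4) ρ := mem_ball_zero_iff.2 hxt
  obtain ⟨hpin, hD1, hD2⟩ := hbounds _ hzt
  have hΓ : ∀ Y X : E4, ‖OpensChart.christoffel gU G (x t) Y X‖ ≤ 3 * L * ‖Y‖ * ‖X‖ :=
    stub_christoffelBound O gU G (x t) L hG hpin hD1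
  have hRb : ∀ a b c e : E4, |gU.val (x t) (gU.riemann (x t) a b c) e| ≤ CR * ‖a‖ * ‖b‖ * ‖c‖ * ‖e‖ :=
    stub_chartRiemannBound O gU G (x t) L (3 * L) hG hpin hD2 (by positivity) hΓ
  -- the adapted frame in the chart at `x t`
  set ξ : E4 := vel t with hξ
  set dΨ := mfderiv 𝓘(ℝ, E4) (𝓡 4) Ψ (x t) with hdΨ
  have hvelt : (dΨ ξ : E4) = (velocity (𝓡 4) γ t : E4) := hvel t htO'
  have hGapp : ∀ a b : E4, gU.val (x t) a b = G (x t) a b := fun a b ↦ congrArg (fun B ↦ B a b) (hG (x t))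
  have hGsym : ∀ a b : E4, G (x t) a b = G (x t) b a := by
    intro a b
    rw [← hGapp, ← hGapp]
    exact gU.symm (x t) a b
  have key_val : ∀ a b : E4, 𝓢.metric.val (γ t) (dΨ a) (dΨ b) = G (x t) a b := by
    intro a b
    rw [← hGapp]
    have h3 : ∀ p, Ψ (x t) = p → 𝓢.metric.val p (dΨ a) (dΨ b) = gU.val (x t) a b := by
      rintro p rfl; rfl
    exact h3 _ (hxΨ t htO'.2)
  have hnullξ : G (x t) ξ ξ = 0 := by
    rw [← key_val, hvelt]
    exact (hnull t ht).1
  have hξ0 : ξ ≠ 0 := by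
    intro h
    have hz : dΨ ξ = 0 := by rw [h]; exact map_zero dΨ
    apply (hnull t ht).2
    have e := hvelt
    rw [hz] at e
    exact e.symm
  -- the speed window at `t`
  have hξM : ‖ξ‖ ≤ M := by
    have h1 := norm_sub_norm_le ξ (vel s)
    rw [hM]; linarith
  have hξm : m ≤ ‖ξ‖ := by
    have h1 := norm_sub_norm_le (vel s) ξ
    rw [norm_sub_rev] at h1
    rw [hm] at hvt ⊢; linarith
  obtain ⟨n, e₂, e₃, hnn, hℓn, h22, h33, h23, hℓ2, hℓ3, hn2', hn3, hnℓ, he2, he3⟩ :=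
    adaptedNullFrame_of_pin (G (x t)) hGsym hpin hnullξ hξ0
  have hn24 : ‖n‖ ≤ 24 / m := by
    rw [le_div_iff₀ hmpos]
    exact (mul_le_mul_of_nonneg_left hξm (norm_nonneg n)).trans hnℓ
  -- push the frame forward by `dΨ`
  set fh : Fin 4 → E4 := ![ξ, n, e₂, e₃] with hfh
  have hKfh : ∀ i : Fin 4, ‖fh i‖ ≤ K₀ := by
    intro i
    fin_cases i
    · exact hξM.trans hMK
    · exact hn24.trans hmK
    · exact he2.trans h74K
    · exact he3.trans h74K
  refine ⟨fun i ↦ (dΨ (fh i) : E4), ⟨?_, ?_, ?_, ?_, ?_, ?_, ?_, ?_, ?_, ?_, ?_⟩, fun a b c e ↦ ?_⟩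
  · show (dΨ ξ : E4) = _
    exact hvelt
  · show 𝓢.metric.val (γ t) (dΨ ξ) (dΨ ξ) = 0
    rw [key_val]; exact hnullξ
  · show 𝓢.metric.val (γ t) (dΨ n) (dΨ n) = 0
    rw [key_val]; exact hnn
  · show 𝓢.metric.val (γ t) (dΨ ξ) (dΨ n) = -1
    rw [key_val]; exact hℓn
  · show 𝓢.metric.val (γ t) (dΨ e₂) (dΨ e₂) = 1
    rw [key_val]; exact h22
  · show 𝓢.metric.val (γ t) (dΨ e₃) (dΨ e₃) = 1
    rw [key_val]; exact h33
  · show 𝓢.metric.val (γ t) (dΨ e₂) (dΨ e₃) = 0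
    rw [key_val]; exact h23
  · show 𝓢.metric.val (γ t) (dΨ ξ) (dΨ e₂) = 0
    rw [key_val]; exact hℓ2
  · show 𝓢.metric.val (γ t) (dΨ ξ) (dΨ e₃) = 0
    rw [key_val]; exact hℓ3
  · show 𝓢.metric.val (γ t) (dΨ n) (dΨ e₂) = 0
    rw [key_val]; exact hn2'
  · show 𝓢.metric.val (γ t) (dΨ n) (dΨ e₃) = 0
    rw [key_val]; exact hn3
  · -- the curvature components: naturality, the chart bound, the frame norms
    have hcurv : 𝓢.metric.val (γ t)
        (CovariantDerivative.curvature 𝓢.metric.leviCivita (γ t) (dΨ (fh a)) (dΨ (fh b)) (dΨ (fh c)))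
        (dΨ (fh e)) = gU.val (x t) (gU.riemann (x t) (fh a) (fh b) (fh c)) (fh e) := by
      have h3 : ∀ p, Ψ (x t) = p → 𝓢.metric.val p
          (CovariantDerivative.curvature 𝓢.metric.leviCivita p (dΨ (fh a)) (dΨ (fh b)) (dΨ (fh c)))
          (dΨ (fh e)) = gU.val (x t) (gU.riemann (x t) (fh a) (fh b) (fh c)) (fh e) := by
        rintro p rfl
        exact val_riemann_immersionChart 𝓢 O Ψ hΨ hΨ' rfl (x t) (fh a) (fh b) (fh c) (fh e)
      exact h3 _ (hxΨ t htO'.2)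
    show |𝓢.metric.val (γ t)
        (CovariantDerivative.curvature 𝓢.metric.leviCivita (γ t) (dΨ (fh a)) (dΨ (fh b)) (dΨ (fh c)))
        (dΨ (fh e))| ≤ CR * K₀ ^ 4
    rw [hcurv]
    have ha := hKfh a
    have hb := hKfh b
    have hc := hKfh c
    have he := hKfh e
    calc |gU.val (x t) (gU.riemann (x t) (fh a) (fh b) (fh c)) (fh e)|
        ≤ CR * ‖fh a‖ * ‖fh b‖ * ‖fh c‖ * ‖fh e‖ := hRb (fh a) (fh b) (fh c) (fh e)
      _ ≤ CR * K₀ * K₀ * K₀ * K₀ := by gcongr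
      _ = CR * K₀ ^ 4 := by ring

end Summit.FinalStateConjecture.FinalStateConjecture.Theorems.PhotonSphereChannels.TameCensorshipUnwind

end
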